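import Literature.NumberTheory.Automorphic.BCDTTheoremACasesFactsProofs
import Literature.NumberTheory.EllipticCurves.DeligneSerreProp27LevelDescentProofs
import HarnessLib

/-!
# CDT Theorem 7.2.2, proofs file II: "(3) ⇒ (2)" with Deligne–Serre (2.7.2) discharged

Sibling proofs file (theorems only: no definitions, no named facts, no `sorry`) of
`Literature.NumberTheory.Automorphic.CDTTheorem722` and
`Literature.NumberTheory.Automorphic.CDTTheorem722Proofs`, for the named fact
`Literature.NumberTheory.Automorphic.BCDT.CDT_theorem_7_2_2` (Conrad–Diamond–Taylor 1999, Thm. 7.2.2: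
*"Let `E/ℚ` be an elliptic curve such that `ρ̄_{E,5}|_{ℚ(√5)}` is absolutely irreducible. If
`ρ̄_{E,5}` is modular, then `E` is modular"*, J. Amer. Math. Soc. 12 (1999), p. 553).

`CDTTheorem722Proofs` proves Breuil–Conrad–Diamond–Taylor's implication **(3) ⇒ (2)** (J. Amer.
Math. Soc. 14 (2001), Introduction, p. 845: *"(3) For some prime `ℓ`, the representation `ρ_{E,ℓ}`
is modular … The implication (3) ⇒ (2) follows from a theorem of Carayol [Ca1] and a theorem of
Faltings [Fa2]"*) from **four** results carried by the tree as catalogued named facts, among them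
`hL : ∀ N, DeligneSerre1974_span_integralLattice1 N 2` — Deligne–Serre 1974, Prop. 2.7 (2.7.2) in
weight `2` (= Shimura 1971, Thm. 3.52): `S₂(Γ₁(N))` is spanned by cusp forms with integral twisted
`q`-expansions, the rational structure behind the conjugates `σ(f)` of an eigenform (Deligne–Serre
(2.7.4)).  That fact has since been **proved** in the tree, at every level and weight:
`DeligneSerre1974_span_integralLattice1_holds`
(`Literature.NumberTheory.EllipticCurves.DeligneSerreProp27LevelDescentProofs`: the rank half of
Eichler–Shimura for `Γ₁(N)`, `N ≥ 5`, by weight-`k` Manin symbols, Shimura's Hecke-stable real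
lattice (3.5.20), and descent of the level `5N → N` through `[α₅]_k` for `N ≤ 4`).

This file substitutes that theorem for `hL` throughout (one-line compositions; the Manin-symbol
imports of the discharge are kept out of `CDTTheorem722Proofs` and `BCDTTheoremACasesFactsProofs`),
leaving (3) ⇒ (2) — and with it the reduction of `CDT_theorem_7_2_2` to its `5`-adic lifting
statement — dependent on **three** catalogued classical facts only:

* `hES : eichlerShimuraConstruction` — the Eichler–Shimura construction (Knapp 1993, Thm. 11.74
  with Thm. 12.8): a rational newform `f ∈ S₂(Γ₀(N))` has an elliptic curve `E_f/ℚ` with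
  `aₙ(E_f) = aₙ(f)`;
* `hF : WeierstrassCurve.isIsogenous_iff_frobeniusTrace_eq` — Faltings' isogeny theorem (Faltings
  1983, §5 Kor. 2);
* `hC : ∀ N, IsNewformOf.level_eq_conductorNorm` — Carayol's theorem, level `=` conductor (Carayol
  1986; Diamond–Shurman Thm. 8.8.1).

## Main statements

* `BCDT.exists_rational_isNewform0_of_isModularGaloisRepTate'` — **unconditional**: if `ρ_{E,ℓ}`
  is modular (`W.IsModularGaloisRepTate ℓ`) then there is a newform `f ∈ S₂(Γ₀(N))` with **integer**
  Fourier coefficients and `a_p(f) = a_p(E)` for every prime `p ∤ N ℓ N_E` (descent `Γ₁ → Γ₀`,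
  the `X`-coefficient of the Frobenius polynomial, conjugation of eigenforms with strong
  multiplicity one, Hecke recursions — Parts 1–5 of `CDTTheorem722Proofs` with (2.7.2) proved).
* `BCDT.isModular_of_isModularGaloisRepTate_of_three_facts` — **(3) ⇒ (2)** for every prime `ℓ`
  from `hES`, `hF`, `hC`; `BCDT.three_imp_two_of_three_facts` (the case `ℓ = 5`, hypothesis `h32`
  of `CDTTheorem722`); `BCDT.isModular_iff_isModularGaloisRepTate_of_three_facts` ((2) ⇔ (3)/(4)).
* `BCDT.CDT_theorem_7_2_2_of_lift_of_three_facts`, `BCDT.CDT_theorem_7_2_2_iff_lift_of_three_facts`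
  — **granted Eichler–Shimura, Faltings and Carayol, the named fact `CDT_theorem_7_2_2` is
  equivalent to the `5`-adic modularity lifting statement of CDT pp. 553–554** (Thm. 7.1.1 =
  Thm. 5.4.2 (`R = T`) with Diamond 1996, Thm. 5.3; Lemma 7.1.3; §2.2; §B.2, Prop. B.4.2; Conrad
  1999, Thm. 5.3), the part of Theorem 7.2.2 that needs the `p`-adic Hodge theory and deformation
  theory absent from Mathlib.
* The assemblies of BCDT Theorem A re-threaded on three facts:
  `BCDT.isModular_of_theoremB_of_CDT721_lift_723_of_three_facts`,
  `BCDT.CDT_theorem_7_1_2_of_theoremB_of_7_2_1_of_lift_of_7_2_3_of_three_facts`,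
  `BCDT.CDT_theorem_7_2_4_of_theoremB_of_7_2_1_of_lift_of_7_2_3_of_ogg3two_of_three_facts`,
  `BCDT.exists_isNewformOf_of_theoremB_of_CDT721_lift_723_of_ogg3two_of_three_facts` (**Theorem A**
  from Theorem B, CDT Thm. 7.2.1, the `5`-adic lifting step, Eichler–Shimura, Faltings, Carayol,
  CDT Lemma 7.2.3 and Ogg's formula for `V₂` at `p = 3`),
  `BCDT.exists_isNewformOf_of_serre_of_CDT721_lift_723_of_ogg3two_of_three_facts` (Theorem B
  replaced by Serre's conjecture at `p = 5`), and
  `BCDT.exists_isNewformOf_of_wild_of_auxiliaryCurve_of_CDT721_lift_723_of_swan_of_three_facts`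
  (Theorem B decomposed, Ogg's formula at `ℓ = 5` in wild form).

## References

* [ConradDiamondTaylor1999] B. Conrad, F. Diamond, R. Taylor, *Modularity of certain potentially
  Barsotti–Tate Galois representations*, J. Amer. Math. Soc. 12 (1999), Thm. 7.2.2 and its proof
  (pp. 553–554).
* [BCDTJAMS2001] C. Breuil, B. Conrad, F. Diamond, R. Taylor, J. Amer. Math. Soc. 14 (2001),
  Introduction, p. 845: conditions (1)–(4), "(3) ⇒ (2) follows from a theorem of Carayol [Ca1] and
  a theorem of Faltings [Fa2]"; proof of Theorem A, cases 1–3.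
* [DeligneSerreASENS1974] P. Deligne, J.-P. Serre, *Formes modulaires de poids 1*, Ann. Sci. ÉNS 7
  (1974): Prop. 2.7, (2.7.2)–(2.7.4).
* [Knapp1993] A. W. Knapp, *Elliptic Curves*: Thm. 11.74, Thm. 12.8.
* [Faltings1983Endlichkeit] G. Faltings, Invent. Math. 73 (1983), §5 Korollar 2.
* [DiamondShurman2005] F. Diamond, J. Shurman, *A First Course in Modular Forms*: Thm. 8.8.1.

## Design

Theorems only; `noncomputable section`; every statement is the corresponding `…_of_facts`
statement of `CDTTheorem722Proofs` / `BCDTTheoremACasesFactsProofs` with the hypothesis `hL` fed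
`DeligneSerre1974_span_integralLattice1_holds N 2` (`span_integralLattice1_two`).  No new named fact
is introduced.  Axioms of every theorem: `propext`, `Classical.choice`, `Quot.sound`.
-/

noncomputable section

open scoped MatrixGroups ModularForm

open CongruenceSubgroup

namespace Literature.NumberTheory.Automorphic.BCDT

open WeierstrassCurve GaloisRepresentations EllipticCurves EllipticCurves.ModularForms

/-! ## Deligne–Serre (2.7.2) in weight `2`, as consumed by `CDTTheorem722Proofs` -/

/-- **Deligne–Serre 1974, (2.7.2) in weight `2` at every level** — the hypothesis `hL` of
`CDTTheorem722Proofs` in the exact shape used there, from the tree's theorem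
`DeligneSerre1974_span_integralLattice1_holds` (`DeligneSerreProp27LevelDescentProofs`).
[cite: DeligneSerreASENS1974, Prop. 2.7 (2.7.2)] -/
theorem span_integralLattice1_two : ∀ (N : ℕ) [NeZero N], DeligneSerre1974_span_integralLattice1 N 2 :=
  fun N _ ↦ DeligneSerre1974_span_integralLattice1_holds N 2

/-! ## (3) ⇒ (2) from Eichler–Shimura, Faltings and Carayol -/

/-- **"`ρ_{E,ℓ}` modular" yields a RATIONAL newform on `Γ₀(N)` with `a_p(f) = a_p(E)` off
`N ℓ N_E`** — unconditionally: if `ρ_{E,ℓ}` is modular (`W.IsModularGaloisRepTate ℓ`: some newform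
`g ∈ S_k(Γ₁(N))` and `ι : K_g ↪ K ⊇ ℚ_ℓ` with `char(Frob_p | T_ℓ E) = ι(X² - a_p(g) X + ε(p)p^{k-1})`
for `p ∤ N ℓ`), then there are `N ≥ 1` and a newform `f ∈ S₂(Γ₀(N))` all of whose Fourier
coefficients are integers, with `a_p(f) = a_p(E)` for every prime `p ∤ N ℓ N_E`.  This is
`exists_rational_isNewform0_of_isModularGaloisRepTate` (`CDTTheorem722Proofs`: descent `Γ₁ → Γ₀`,
`X`-coefficients of the Frobenius polynomial, Deligne–Serre conjugation (2.7.4) with strong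
multiplicity one on `Γ₀(N)` off finitely many primes, integrality of the `a_p` (Shimura Thm. 3.48)
and the Hecke recursions) with Deligne–Serre (2.7.2) supplied by `span_integralLattice1_two`.
[cite: BCDTJAMS2001, Introduction ((3) ⇒ (2))] -/
theorem exists_rational_isNewform0_of_isModularGaloisRepTate'
    (W : WeierstrassCurve ℚ) [W.IsElliptic] (ℓ : ℕ) [Fact ℓ.Prime] (h : W.IsModularGaloisRepTate ℓ) :
    ∃ (N : ℕ) (_ : NeZero N) (f : CuspForm (Gamma0 N) 2), IsNewform0 f ∧
      (∀ n : ℕ, ∃ z : ℤ, cuspCoeff f n = z) ∧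
      ∀ p : ℕ, p.Prime → ¬ p ∣ N * (ℓ * W.conductorNorm ℤ) → cuspCoeff f p = (W.LFunction p : ℂ) :=
  exists_rational_isNewform0_of_isModularGaloisRepTate span_integralLattice1_two W ℓ h

/-- **Breuil–Conrad–Diamond–Taylor 2001, Introduction, (3) ⇒ (2): if `ρ_{E,ℓ}` is modular then `E`
is modular** — *"The implication (3) ⇒ (2) follows from a theorem of Carayol [Ca1] and a theorem of
Faltings [Fa2]"* — from THREE catalogued named facts of the tree:

* `hES` — the Eichler–Shimura construction (`eichlerShimuraConstruction`; Knapp Thm. 11.74 with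
  Thm. 12.8): a rational newform `f ∈ S₂(Γ₀(N))` has an elliptic curve `E_f/ℚ` with
  `aₙ(E_f) = aₙ(f)`;
* `hF` — Faltings' isogeny theorem (`WeierstrassCurve.isIsogenous_iff_frobeniusTrace_eq`; Faltings
  1983, §5 Kor. 2);
* `hC` — Carayol's theorem, level `=` conductor (`IsNewformOf.level_eq_conductorNorm`; Carayol
  1986; Diamond–Shurman Thm. 8.8.1).

This is `isModular_of_isModularGaloisRepTate_of_facts` (`CDTTheorem722Proofs`) with its fourth input,
Deligne–Serre (2.7.2) in weight `2`, discharged by `span_integralLattice1_two`: the rational newform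
`f` of `exists_rational_isNewform0_of_isModularGaloisRepTate'` has an Eichler–Shimura curve `E_f`
with `a_p(E_f) = a_p(f) = a_p(E)` off `N ℓ N_E`, so `E ~ E_f` over `ℚ` (Faltings), whence
`L(E, s) = L(E_f, s) = L(f, s)` (isogeny invariance, `IsIsogenous.LFunction_eq`) and `N = N_E`
(Carayol). [cite: BCDTJAMS2001, Introduction ((3) ⇒ (2))] -/
theorem isModular_of_isModularGaloisRepTate_of_three_facts
    (hES : eichlerShimuraConstruction)
    (hF : WeierstrassCurve.isIsogenous_iff_frobeniusTrace_eq)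
    (hC : ∀ (N : ℕ) [NeZero N], IsNewformOf.level_eq_conductorNorm (N := N))
    (W : WeierstrassCurve ℚ) [W.IsElliptic] [NeZero (W.conductorNorm ℤ)] (ℓ : ℕ) [Fact ℓ.Prime]
    (h : W.IsModularGaloisRepTate ℓ) : IsModular W :=
  isModular_of_isModularGaloisRepTate_of_facts span_integralLattice1_two hES hF hC W ℓ h

/-- **(3) ⇒ (2) at `ℓ = 5`**, the hypothesis `h32` of `CDTTheorem722`, from Eichler–Shimura,
Faltings and Carayol (`isModular_of_isModularGaloisRepTate_of_three_facts`).
[cite: BCDTJAMS2001, Introduction ((3) ⇒ (2))] -/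
theorem three_imp_two_of_three_facts
    (hES : eichlerShimuraConstruction)
    (hF : WeierstrassCurve.isIsogenous_iff_frobeniusTrace_eq)
    (hC : ∀ (N : ℕ) [NeZero N], IsNewformOf.level_eq_conductorNorm (N := N)) :
    ∀ (W : WeierstrassCurve ℚ) [W.IsElliptic] [NeZero (W.conductorNorm ℤ)],
      W.IsModularGaloisRepTate 5 → IsModular W :=
  fun W _ _ h ↦ isModular_of_isModularGaloisRepTate_of_three_facts hES hF hC W 5 h

/-- **Conditions (2), (3), (4) of BCDT's Introduction agree, from Eichler–Shimura, Faltings and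
Carayol**: for an elliptic `W / ℚ` and any prime `ℓ`, `E` is modular iff `ρ_{E,ℓ}` is modular
((2) ⇒ (4) being the theorem `IsModular.isModularGaloisRepTate`, (3) ⇒ (2) being
`isModular_of_isModularGaloisRepTate_of_three_facts`).
[cite: BCDTJAMS2001, Introduction (conditions (2)–(4))] -/
theorem isModular_iff_isModularGaloisRepTate_of_three_facts
    (hES : eichlerShimuraConstruction)
    (hF : WeierstrassCurve.isIsogenous_iff_frobeniusTrace_eq)
    (hC : ∀ (N : ℕ) [NeZero N], IsNewformOf.level_eq_conductorNorm (N := N))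
    (W : WeierstrassCurve ℚ) [W.IsElliptic] [NeZero (W.conductorNorm ℤ)] (ℓ : ℕ) [Fact ℓ.Prime] :
    IsModular W ↔ W.IsModularGaloisRepTate ℓ :=
  ⟨fun h ↦ h.isModularGaloisRepTate ℓ, isModular_of_isModularGaloisRepTate_of_three_facts hES hF hC W ℓ⟩

/-! ## CDT Theorem 7.2.2 versus its `5`-adic lifting statement, granted three facts -/

/-- **Conrad–Diamond–Taylor 1999, Theorem 7.2.2 from its `5`-adic lifting statement, granted
Eichler–Shimura, Faltings and Carayol**: the `5`-adic modularity lifting statement proved on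
pp. 553–554 of CDT (`hlift`: for every elliptic `W / ℚ` and framed model `ρ̄` of `E[5]`,
`ρ̄|_{ℚ(√5)}` absolutely irreducible and `ρ̄` modular imply `ρ_{E,5}` modular; there from Thm. 7.1.1
and Diamond 1996, Thm. 5.3) implies the named fact `CDT_theorem_7_2_2`
(`CDT_theorem_7_2_2_of_lift_of_three_imp_two` with `three_imp_two_of_three_facts`).
[cite: ConradDiamondTaylor1999, Thm. 7.2.2 (proof, pp. 553–554)] -/
theorem CDT_theorem_7_2_2_of_lift_of_three_facts
    (hES : eichlerShimuraConstruction)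
    (hF : WeierstrassCurve.isIsogenous_iff_frobeniusTrace_eq)
    (hC : ∀ (N : ℕ) [NeZero N], IsNewformOf.level_eq_conductorNorm (N := N))
    (hlift : ∀ (W : WeierstrassCurve ℚ) [W.IsElliptic] (ρ : ModPGaloisRep ℚ (ZMod 5) 2),
      W.IsTorsionGaloisRep 5 ρ → ρ.IsAbsIrreducibleOverSqrt 5 → ρ.IsModular →
      W.IsModularGaloisRepTate 5) :
    CDT_theorem_7_2_2 :=
  CDT_theorem_7_2_2_of_lift_of_three_imp_two hlift (three_imp_two_of_three_facts hES hF hC)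

/-- **Inside the tree, CDT Theorem 7.2.2 is equivalent to its `5`-adic (Galois-theoretic) form,
granted only Eichler–Shimura, Faltings and Carayol**: what the named fact `CDT_theorem_7_2_2`
asserts beyond those three catalogued classical facts is exactly the `5`-adic modularity lifting
statement of pp. 553–554 of CDT (`CDT_theorem_7_2_2_iff_lift` with `three_imp_two_of_three_facts`;
the converse direction is the theorem `IsModular.isModularGaloisRepTate`, (2) ⇒ (4)).
[cite: ConradDiamondTaylor1999, Thm. 7.2.2 (proof, pp. 553–554)] -/
theorem CDT_theorem_7_2_2_iff_lift_of_three_facts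
    (hES : eichlerShimuraConstruction)
    (hF : WeierstrassCurve.isIsogenous_iff_frobeniusTrace_eq)
    (hC : ∀ (N : ℕ) [NeZero N], IsNewformOf.level_eq_conductorNorm (N := N)) :
    CDT_theorem_7_2_2 ↔
      ∀ (W : WeierstrassCurve ℚ) [W.IsElliptic] (ρ : ModPGaloisRep ℚ (ZMod 5) 2),
        W.IsTorsionGaloisRep 5 ρ → ρ.IsAbsIrreducibleOverSqrt 5 → ρ.IsModular →
        W.IsModularGaloisRepTate 5 :=
  CDT_theorem_7_2_2_iff_lift (three_imp_two_of_three_facts hES hF hC)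

/-! ## BCDT Theorem A re-threaded on three facts -/

/-- **BCDT, proof of Theorem A for a given `E / ℚ` by the three cases of the Introduction, with
"(3) ⇒ (2)" from Eichler–Shimura, Faltings and Carayol** — `isModular_of_theoremB_of_CDT721_lift_32_723`
(`BCDTTheoremACasesOggTwoProofs`) with `h32` discharged by `three_imp_two_of_three_facts`.  Inputs:
Theorem B, CDT Thm. 7.2.1, the `5`-adic lifting statement `hlift` of CDT Thm. 7.2.2 (proof,
pp. 553–554), the three classical facts, CDT Lemma 7.2.3 (modularity), and the per-curve `h27`
("`ρ̄_{E,5}|_{ℚ(√5)}` not absolutely irreducible ⇒ `27 ∤ N_E`").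
[cite: BCDTJAMS2001, Introduction (proof of Theorem A, cases 1–3; (3) ⇒ (2))]
[cite: ConradDiamondTaylor1999, Thm. 7.2.2 (proof, pp. 553–554)] -/
theorem isModular_of_theoremB_of_CDT721_lift_723_of_three_facts (hB : theoremB)
    (h721 : CDT_theorem_7_2_1)
    (hlift : ∀ (W : WeierstrassCurve ℚ) [W.IsElliptic] (ρ : ModPGaloisRep ℚ (ZMod 5) 2),
      W.IsTorsionGaloisRep 5 ρ → ρ.IsAbsIrreducibleOverSqrt 5 → ρ.IsModular →
      W.IsModularGaloisRepTate 5)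
    (hES : eichlerShimuraConstruction)
    (hF : WeierstrassCurve.isIsogenous_iff_frobeniusTrace_eq)
    (hC : ∀ (N : ℕ) [NeZero N], IsNewformOf.level_eq_conductorNorm (N := N))
    (h723 : CDT_lemma_7_2_3_isModular)
    (W : WeierstrassCurve ℚ) [W.IsElliptic] [NeZero (W.conductorNorm ℤ)]
    (h27 : ∀ ρ : ModPGaloisRep ℚ (ZMod 5) 2, W.IsTorsionGaloisRep 5 ρ →
      ¬ ρ.IsAbsIrreducibleOverSqrt 5 → ¬ 27 ∣ W.conductorNorm ℤ) :
    IsModular W :=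
  isModular_of_theoremB_of_CDT721_lift_32_723 hB h721 hlift (three_imp_two_of_three_facts hES hF hC)
    h723 W h27

/-- **Conrad–Diamond–Taylor 1999, Theorem 7.1.2** (the named fact `CDT_theorem_7_1_2`: `E / ℚ`
with `27 ∤ N_E` is modular) **from Theorem B, CDT Thm. 7.2.1, the `5`-adic lifting step of
Thm. 7.2.2, Eichler–Shimura, Faltings, Carayol, and Lemma 7.2.3** — no `3`–`5` switch, no Ogg or
Galois-side input: `CDT_theorem_7_1_2_of_theoremB_of_7_2_1_of_7_2_2_of_7_2_3`
(`BCDTTheoremACasesProofs`) with `CDT_theorem_7_2_2` supplied by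
`CDT_theorem_7_2_2_of_lift_of_three_facts`.
[cite: ConradDiamondTaylor1999, Thm. 7.1.2 and Thm. 7.2.2 (proof, pp. 553–556)]
[cite: BCDTJAMS2001, Introduction (proof of Theorem A; (3) ⇒ (2))] -/
theorem CDT_theorem_7_1_2_of_theoremB_of_7_2_1_of_lift_of_7_2_3_of_three_facts (hB : theoremB)
    (h721 : CDT_theorem_7_2_1)
    (hlift : ∀ (W : WeierstrassCurve ℚ) [W.IsElliptic] (ρ : ModPGaloisRep ℚ (ZMod 5) 2),
      W.IsTorsionGaloisRep 5 ρ → ρ.IsAbsIrreducibleOverSqrt 5 → ρ.IsModular →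
      W.IsModularGaloisRepTate 5)
    (hES : eichlerShimuraConstruction)
    (hF : WeierstrassCurve.isIsogenous_iff_frobeniusTrace_eq)
    (hC : ∀ (N : ℕ) [NeZero N], IsNewformOf.level_eq_conductorNorm (N := N))
    (h723 : CDT_lemma_7_2_3_isModular) :
    CDT_theorem_7_1_2 :=
  CDT_theorem_7_1_2_of_theoremB_of_7_2_1_of_7_2_2_of_7_2_3 hB h721
    (CDT_theorem_7_2_2_of_lift_of_three_facts hES hF hC hlift) h723

/-- **Conrad–Diamond–Taylor 1999, Theorem 7.2.4** (the named fact `CDT_theorem_7_2_4`) **from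
Theorem B, CDT Thm. 7.2.1, the `5`-adic lifting step of Thm. 7.2.2, Eichler–Shimura, Faltings,
Carayol, Lemma 7.2.3 and Ogg's formula for `V₂` at `p = 3`**:
`CDT_theorem_7_2_4_of_theoremB_of_7_2_1_of_7_2_2_of_7_2_3_of_ogg3two`
(`BCDTTheoremACasesOggTwoProofs`) with `CDT_theorem_7_2_2` supplied by
`CDT_theorem_7_2_2_of_lift_of_three_facts`.
[cite: ConradDiamondTaylor1999, Thm. 7.2.4 (p. 556) and Thm. 7.2.2 (proof, pp. 553–554)] -/
theorem CDT_theorem_7_2_4_of_theoremB_of_7_2_1_of_lift_of_7_2_3_of_ogg3two_of_three_facts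
    (hB : theoremB) (h721 : CDT_theorem_7_2_1)
    (hlift : ∀ (W : WeierstrassCurve ℚ) [W.IsElliptic] (ρ : ModPGaloisRep ℚ (ZMod 5) 2),
      W.IsTorsionGaloisRep 5 ρ → ρ.IsAbsIrreducibleOverSqrt 5 → ρ.IsModular →
      W.IsModularGaloisRepTate 5)
    (hES : eichlerShimuraConstruction)
    (hF : WeierstrassCurve.isIsogenous_iff_frobeniusTrace_eq)
    (hC : ∀ (N : ℕ) [NeZero N], IsNewformOf.level_eq_conductorNorm (N := N))
    (h723 : CDT_lemma_7_2_3_isModular)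
    (hOgg3two : ∀ W : WeierstrassCurve ℚ,
      W.swanConductorAt_rationalTate_eq_wildConductorExponent_of_ringChar_eq_three 2) :
    CDT_theorem_7_2_4 :=
  CDT_theorem_7_2_4_of_theoremB_of_7_2_1_of_7_2_2_of_7_2_3_of_ogg3two hB h721
    (CDT_theorem_7_2_2_of_lift_of_three_facts hES hF hC hlift) h723 hOgg3two

/-- **BCDT Theorem A** (`Literature.NumberTheory.EllipticCurves.ModularForms.exists_isNewformOf`,
the Modularity Theorem in the tree's form) **from Theorem B, CDT Thm. 7.2.1, the `5`-adic lifting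
step of CDT Thm. 7.2.2, Eichler–Shimura, Faltings, Carayol, CDT Lemma 7.2.3 (modularity) and Ogg's
formula for the `2`-adic Tate module at the additive places of residue characteristic `3`** — the
three cases of BCDT's Introduction for every curve, Theorem B kept whole, no `3`–`5` switch, no
auxiliary curve: `exists_isNewformOf_of_theoremB_of_CDT721_lift_32_723_of_ogg3two`
(`BCDTTheoremACasesOggTwoProofs`) with `h32` discharged by `three_imp_two_of_three_facts`.  Every
input is a catalogued named fact of the tree except the printed `5`-adic lifting statement `hlift`
(CDT Thm. 7.2.2, proof, pp. 553–554); compared with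
`exists_isNewformOf_of_theoremB_of_CDT721_lift_723_of_ogg3two_of_facts`
(`BCDTTheoremACasesFactsProofs`) the input Deligne–Serre (2.7.2) is gone (proved).
[cite: BCDTJAMS2001, Theorem A; Introduction (proof of Theorem A, cases 1–3; (3) ⇒ (2))] -/
theorem exists_isNewformOf_of_theoremB_of_CDT721_lift_723_of_ogg3two_of_three_facts (hB : theoremB)
    (h721 : CDT_theorem_7_2_1)
    (hlift : ∀ (W : WeierstrassCurve ℚ) [W.IsElliptic] (ρ : ModPGaloisRep ℚ (ZMod 5) 2),
      W.IsTorsionGaloisRep 5 ρ → ρ.IsAbsIrreducibleOverSqrt 5 → ρ.IsModular →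
      W.IsModularGaloisRepTate 5)
    (hES : eichlerShimuraConstruction)
    (hF : WeierstrassCurve.isIsogenous_iff_frobeniusTrace_eq)
    (hC : ∀ (N : ℕ) [NeZero N], IsNewformOf.level_eq_conductorNorm (N := N))
    (h723 : CDT_lemma_7_2_3_isModular)
    (hOgg3two : ∀ W : WeierstrassCurve ℚ,
      W.swanConductorAt_rationalTate_eq_wildConductorExponent_of_ringChar_eq_three 2) :
    EllipticCurves.ModularForms.exists_isNewformOf :=
  exists_isNewformOf_of_theoremB_of_CDT721_lift_32_723_of_ogg3two hB h721 hlift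
    (three_imp_two_of_three_facts hES hF hC) h723 hOgg3two

/-- **Theorem A from Serre's conjecture (3.2.3) at `p = 5` in place of Theorem B**, with the same
finer inputs (CDT Thm. 7.2.1, the `5`-adic lifting step of Thm. 7.2.2, Eichler–Shimura, Faltings,
Carayol, Lemma 7.2.3, Ogg's formula for `V₂` at `p = 3`): Theorem B is the case `p = 5`, `k = 𝔽₅`
of the named fact `exists_newform_of_odd_irreducible` (`SerreConjecture`; Serre (3.2.3),
Khare–Wintenberger 2009, Thm. 1.2) by `theoremB_of_exists_newform_of_odd_irreducible`
(`BCDTModularitySerreProofs`). [cite: BCDTJAMS2001, Introduction; Theorem A] -/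
theorem exists_isNewformOf_of_serre_of_CDT721_lift_723_of_ogg3two_of_three_facts
    (hSerre : ∀ (k : Type) [Field k] [TopologicalSpace k] [DiscreteTopology k],
      exists_newform_of_odd_irreducible (p := 5) (k := k))
    (h721 : CDT_theorem_7_2_1)
    (hlift : ∀ (W : WeierstrassCurve ℚ) [W.IsElliptic] (ρ : ModPGaloisRep ℚ (ZMod 5) 2),
      W.IsTorsionGaloisRep 5 ρ → ρ.IsAbsIrreducibleOverSqrt 5 → ρ.IsModular →
      W.IsModularGaloisRepTate 5)
    (hES : eichlerShimuraConstruction)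
    (hF : WeierstrassCurve.isIsogenous_iff_frobeniusTrace_eq)
    (hC : ∀ (N : ℕ) [NeZero N], IsNewformOf.level_eq_conductorNorm (N := N))
    (h723 : CDT_lemma_7_2_3_isModular)
    (hOgg3two : ∀ W : WeierstrassCurve ℚ,
      W.swanConductorAt_rationalTate_eq_wildConductorExponent_of_ringChar_eq_three 2) :
    EllipticCurves.ModularForms.exists_isNewformOf :=
  exists_isNewformOf_of_theoremB_of_CDT721_lift_723_of_ogg3two_of_three_facts
    (theoremB_of_exists_newform_of_odd_irreducible hSerre) h721 hlift hES hF hC h723 hOgg3two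

/-- **The Modularity Theorem (BCDT Theorem A, `exists_isNewformOf`) from the deep printed inputs,
with Theorem B decomposed, CDT Theorem 7.2.2 unfolded into its `5`-adic lifting step, and (3) ⇒ (2)
from Eichler–Shimura, Faltings and Carayol**: as
`exists_isNewformOf_of_wild_of_auxiliaryCurve_of_CDT721_lift_32_723_of_swan` (`CDTTheorem722`) with
`h32` discharged by `three_imp_two_of_three_facts`.  Granted (i) the wild case of BCDT Thm. 2.2.1,
(ii) the Shepherd-Barron–Taylor auxiliary curve, (iii) CDT Thm. 7.2.1, (iv) the `5`-adic lifting
statement for `ρ_{E,5}` (CDT Thm. 7.2.2, proof), (v) the Eichler–Shimura construction,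
(vi) Faltings' isogeny theorem, (vii) Carayol's theorem, (viii) the modularity conclusion of CDT
Lemma 7.2.3 and (ix) Ogg's formula at `ℓ = 5` in its wild form, every elliptic curve over `ℚ` is
modular. [cite: BCDTJAMS2001, Theorem A] -/
theorem exists_isNewformOf_of_wild_of_auxiliaryCurve_of_CDT721_lift_723_of_swan_of_three_facts
    (hW : exists_isTorsionGaloisRep_and_isModular_of_not_isTamelyRamifiedAbove)
    (hE : exists_isTorsionGaloisRep_five_and_surjective_three) (h721 : CDT_theorem_7_2_1)
    (hlift : ∀ (W : WeierstrassCurve ℚ) [W.IsElliptic] (ρ : ModPGaloisRep ℚ (ZMod 5) 2),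
      W.IsTorsionGaloisRep 5 ρ → ρ.IsAbsIrreducibleOverSqrt 5 → ρ.IsModular →
      W.IsModularGaloisRepTate 5)
    (hES : eichlerShimuraConstruction)
    (hF : WeierstrassCurve.isIsogenous_iff_frobeniusTrace_eq)
    (hC : ∀ (N : ℕ) [NeZero N], IsNewformOf.level_eq_conductorNorm (N := N))
    (h723 : CDT_lemma_7_2_3_isModular)
    (hSw : ∀ W : WeierstrassCurve ℚ, W.swanConductorAt_rationalTate_eq_wildConductorExponent 5) :
    exists_isNewformOf :=
  exists_isNewformOf_of_wild_of_auxiliaryCurve_of_CDT721_lift_32_723_of_swan hW hE h721 hlift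
    (three_imp_two_of_three_facts hES hF hC) h723 hSw

end Literature.NumberTheory.Automorphic.BCDT

end
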